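import Literature.Probability.Percolation.PlanarDuality
import Literature.Probability.Percolation.PercolationProofs
import Literature.Probability.Percolation.PercolationEvents
import HarnessLib

/-!
# `NoHeavyLowerTail` (stmt-CriticalPhenomena-4575) — APL for light targets, I: paths and determination

Support file (prover prim-ineq-prove-5 gen 38; `--supports stmt-CriticalPhenomena-4575`; memo
run/shared/lean/prim/prim-ineq-prove-5/FROM-prim-ineq-prove-5-g37-APL-STRUCTURE.md §3.3, theorem (L)).
No definitions, no named facts, no sorries.  Part I of three (`…APLLightTargetsPaths`, `…APLLightTargetsMarkov`,
`…APLLightTargets`): the combinatorics of the APEX CLUSTER OFF THE TARGETS,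
`K0(ω) = openCluster (ω ∩ {e | b ∉ e ∧ c ∉ e}) a` — the open cluster of the apex `a` in `G − {b, c}` — used to
disintegrate the reverse-Harris three-point row APL (see part III for the statement):
* `offCluster_ne`, `mem_offCluster_of_adj` — `K0` avoids `b, c` and is closed under open steps avoiding them;
* `exists_exit_of_openConn` — an open path from `a` to `b` or `c` uses an open pair from `K0` to `b` or to `c`;
* `openConn_of_exit` — conversely such a pair joins `a` to the target;
* `not_openConn_of_noExit` — on `{K0 = K}`, no open pair `K–c` and `b ↮ c` inside `Kᶜ` force `a ↮ c`;
* `determinedBy_of_restrict`, `determinedBy_exists_pair` — bookkeeping for events determined by sets of pairs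
  (complements/unions: `Quant.determinedBy_compl_of`, `Quant.determinedBy_union_of` of `…NoHeavyQuantLevelTrials`).
[cite: Grimmett1999, §1.3 (open paths), §2.2 (events determined by edge sets)]
-/

noncomputable section

open scoped Classical

namespace Summit.CriticalPhenomena.PercolationContinuityZ3.Theorems

namespace APL

open MeasureTheory Literature.Probability.Percolation Literature.Probability.LatticeModels

/-! ### Paths: the apex cluster off the targets -/

section Paths

variable {V : Type*}

/-- The cluster of `a` among the pairs avoiding `b, c` avoids `b` and `c` (for `a ≠ b, c`). [folklore] -/
theorem offCluster_ne {a b c y : V} {ω : BondConfig V} (hab : a ≠ b) (hac : a ≠ c)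
    (hy : y ∈ openCluster (ω ∩ {e | b ∉ e ∧ c ∉ e}) a) : y ≠ b ∧ y ≠ c := by
  have hr : (openGraph (ω ∩ {e | b ∉ e ∧ c ∉ e})).Reachable a y := hy
  rw [SimpleGraph.reachable_iff_reflTransGen] at hr
  induction hr with
  | refl => exact ⟨hab, hac⟩
  | @tail x z _ hxz _ =>
    have h' := (openGraph_adj _ x z).1 hxz
    have hoff : b ∉ s(x, z) ∧ c ∉ s(x, z) := h'.1.2
    exact ⟨fun hzb => hoff.1 (hzb ▸ Sym2.mem_mk_right x z), fun hzc => hoff.2 (hzc ▸ Sym2.mem_mk_right x z)⟩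

/-- The cluster of `a` among the pairs avoiding `b, c` is closed under open steps between vertices other than
`b, c`. [folklore] -/
theorem mem_offCluster_of_adj {a b c x z : V} {ω : BondConfig V}
    (hx : x ∈ openCluster (ω ∩ {e | b ∉ e ∧ c ∉ e}) a) (hxz : s(x, z) ∈ ω) (hne : x ≠ z)
    (hxb : x ≠ b) (hxc : x ≠ c) (hzb : z ≠ b) (hzc : z ≠ c) :
    z ∈ openCluster (ω ∩ {e | b ∉ e ∧ c ∉ e}) a := by
  have hr : (openGraph (ω ∩ {e | b ∉ e ∧ c ∉ e})).Reachable a x := hx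
  have hadj : (openGraph (ω ∩ {e | b ∉ e ∧ c ∉ e})).Adj x z := by
    rw [openGraph_adj]
    refine ⟨⟨hxz, ?_, ?_⟩, hne⟩
    · intro hb
      rcases Sym2.mem_iff.1 hb with h | h
      · exact hxb h.symm
      · exact hzb h.symm
    · intro hc
      rcases Sym2.mem_iff.1 hc with h | h
      · exact hxc h.symm
      · exact hzc h.symm
  exact hr.trans hadj.reachable

/-- **Exit lemma.**  If `a ↔ t` with `t ∈ {b, c}` (`a ≠ b, c`), then some open pair joins the cluster of `a` off
`{b,c}` to `b` or to `c`. [folklore] -/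
theorem exists_exit_of_openConn {a b c t : V} {ω : BondConfig V} (hab : a ≠ b) (hac : a ≠ c)
    (ht : t = b ∨ t = c) (h : ω ∈ openConn a t) :
    ∃ k ∈ openCluster (ω ∩ {e | b ∉ e ∧ c ∉ e}) a, s(k, b) ∈ ω ∨ s(k, c) ∈ ω := by
  have hr : (openGraph ω).Reachable a t := h
  rw [SimpleGraph.reachable_iff_reflTransGen] at hr
  -- invariant along the walk
  have key : ∀ z, Relation.ReflTransGen (openGraph ω).Adj a z →
      z ∈ openCluster (ω ∩ {e | b ∉ e ∧ c ∉ e}) a ∨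
        ∃ k ∈ openCluster (ω ∩ {e | b ∉ e ∧ c ∉ e}) a, s(k, b) ∈ ω ∨ s(k, c) ∈ ω := by
    intro z hz
    induction hz with
    | refl => exact Or.inl (mem_openCluster_self _ a)
    | @tail x z _ hxz ih =>
      rcases ih with hx | hdone
      · have h' := (openGraph_adj ω x z).1 hxz
        have hxbc := offCluster_ne hab hac hx
        by_cases hzb : z = b
        · subst hzb; exact Or.inr ⟨x, hx, Or.inl h'.1⟩
        by_cases hzc : z = c
        · subst hzc; exact Or.inr ⟨x, hx, Or.inr h'.1⟩
        exact Or.inl (mem_offCluster_of_adj hx h'.1 h'.2 hxbc.1 hxbc.2 hzb hzc)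
      · exact Or.inr hdone
  rcases key t hr with htK | hdone
  · have := offCluster_ne hab hac htK
    rcases ht with rfl | rfl
    · exact absurd rfl this.1
    · exact absurd rfl this.2
  · exact hdone

/-- An open pair from the cluster of `a` in a sub-configuration to `t` joins `a` to `t`. [folklore] -/
theorem openConn_of_exit {a t k : V} {ω : BondConfig V} {E : Set (Sym2 V)}
    (hk : k ∈ openCluster (ω ∩ E) a) (hkt : s(k, t) ∈ ω) (hne : k ≠ t) :
    ω ∈ openConn a t := by
  have hk' : k ∈ openCluster ω a := openCluster_mono Set.inter_subset_left a hk
  have hr : (openGraph ω).Reachable a k := hk'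
  have hadj : (openGraph ω).Adj k t := by rw [openGraph_adj]; exact ⟨hkt, hne⟩
  exact hr.trans hadj.reachable

/-- **No way to `c`.**  On `{K0 = K}`, if no pair `{k, c}` (`k ∈ K`) is open and `b ↮ c` inside `Kᶜ`, then
`a ↮ c`: an open path from `a` would leave `K` through `b` and then join `b` to `c` inside `Kᶜ`. [folklore] -/
theorem not_openConn_of_noExit {a b c : V} {ω : BondConfig V} {K : Set V} (hab : a ≠ b) (hac : a ≠ c)
    (hK : openCluster (ω ∩ {e | b ∉ e ∧ c ∉ e}) a = K) (hKc : ∀ k ∈ K, s(k, c) ∉ ω)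
    (hF : ω ∉ openConnIn Kᶜ b c) : ω ∉ openConn a c := by
  intro h
  have hr : (openGraph ω).Reachable a c := h
  rw [SimpleGraph.reachable_iff_reflTransGen] at hr
  have hbK : b ∉ K := fun hb => (offCluster_ne hab hac (hK ▸ hb : b ∈ openCluster _ a)).1 rfl
  have hcK : c ∉ K := fun hc => (offCluster_ne hab hac (hK ▸ hc : c ∈ openCluster _ a)).2 rfl
  have key : ∀ z, Relation.ReflTransGen (openGraph ω).Adj a z → z ∈ K ∨ ω ∈ openConnIn Kᶜ b z := by
    intro z hz
    induction hz with
    | refl => exact Or.inl (hK ▸ mem_openCluster_self _ a)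
    | @tail x z _ hxz ih =>
      have h' := (openGraph_adj ω x z).1 hxz
      by_cases hzK : z ∈ K
      · exact Or.inl hzK
      right
      rcases ih with hx | hx
      · -- `x ∈ K`: the step leaves `K`, hence goes to `b` (to `c` is excluded, elsewhere stays in `K`)
        have hxK : x ∈ openCluster (ω ∩ {e | b ∉ e ∧ c ∉ e}) a := hK ▸ hx
        have hxbc := offCluster_ne hab hac hxK
        by_cases hzb : z = b
        · subst hzb; exact openConnIn_refl hbK
        by_cases hzc : z = c
        · subst hzc; exact absurd h'.1 (hKc x hx)
        exact absurd (hK ▸ mem_offCluster_of_adj hxK h'.1 h'.2 hxbc.1 hxbc.2 hzb hzc) hzK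
      · obtain ⟨hbS, hxS, hr⟩ := hx
        exact PlanarDuality.openConnIn_trans ⟨hbS, hxS, hr⟩ (openConnIn_of_adj hxS hzK h'.1 h'.2)
  rcases key c hr with hc | hc
  · exact hcK hc
  · exact hF hc

end Paths

/-! ### Determination by sets of pairs -/

section Determined

variable {ι : Type*}

/-- Restricting the configuration: if `A` is determined by `F` then `{ω | ω ∩ E ∈ A}` is determined by `F ∩ E`.
[folklore] -/
theorem determinedBy_of_restrict {A : Set (Set ι)} {F : Set ι} (E : Set ι) (h : DeterminedBy A F) :
    DeterminedBy {ω | ω ∩ E ∈ A} (F ∩ E) := by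
  rw [determinedBy_iff] at h ⊢
  intro ω ω' hω
  simp only [Set.mem_setOf_eq]
  refine h _ _ ?_
  have h1 : ω ∩ E ∩ F = ω ∩ (F ∩ E) := by rw [Set.inter_assoc, Set.inter_comm E F]
  have h2 : ω' ∩ E ∩ F = ω' ∩ (F ∩ E) := by rw [Set.inter_assoc, Set.inter_comm E F]
  rw [h1, h2, hω]

variable {V : Type*}

/-- `{some pair {k, b}, k ∈ T, is open}` is determined by those pairs. [folklore] -/
theorem determinedBy_exists_pair (T : Set V) (b : V) :
    DeterminedBy {ω : BondConfig V | ∃ k ∈ T, s(k, b) ∈ ω} {e | ∃ k ∈ T, e = s(k, b)} := by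
  rw [determinedBy_iff]
  intro ω ω' hω
  simp only [Set.mem_setOf_eq]
  refine exists_congr fun k => and_congr_right fun hk => ?_
  have he : s(k, b) ∈ {e : Sym2 V | ∃ k ∈ T, e = s(k, b)} := ⟨k, hk, rfl⟩
  exact ⟨fun h1 => ((Set.ext_iff.1 hω _).1 ⟨h1, he⟩).1, fun h1 => ((Set.ext_iff.1 hω _).2 ⟨h1, he⟩).1⟩

end Determined

end APL

end Summit.CriticalPhenomena.PercolationContinuityZ3.Theorems

end
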